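import Mathlib.Analysis.SpecialFunctions.Log.Monotone
import Summits.RiemannHypothesis.RiemannHypothesis.Theorems.LiDirichletAsymptoticDefs
import Summits.RiemannHypothesis.RiemannHypothesis.Theorems.LiAsymptoticLiAsymptoticBudget
import Summits.RiemannHypothesis.RiemannHypothesis.Theorems.HandoffEdgeChebyshev
import Literature.NumberTheory.LFunctions.SchoenfeldZeroSumsExplicit
import HarnessLib

/-!
# RiemannHypothesis / LiDirichletAsymptotic — crux K4χ `LiBudgetChar`, helper: the LINEARISED PIECES (RH-FREE · GRH-FREE)

RH-FREE · GRH-FREE PROOF-OF-DATA (rung L-P(P1⁺χ)) [rh-li-prover].  Helper for item `LiBudgetChar`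
(stmt-RiemannHypothesis-19631) of route `Theses/LiDirichletAsymptotic.lean` (cell `pub/rh-li`, round 5 (iii)); the closer is
`Theorems/LiDirichletAsymptoticLiBudgetChar.lean`.  With `s = √n`, `L = log q`, `u = L + (log n)/2`, every piece of the
error budget is bounded LINEARLY in the atoms `s·u, s, u, L, log n, 1`, uniformly in the conductor `q ≥ 2`:

* `charErrFar q n T ≤ (0.0562 s + 0.0398)(u + 0.6932)` on the whole admissible region (`n ≤ T²/4` gives `T ≥ 2s ≥ 60 ≥ e`;
  `log T/T` is decreasing — `Real.log_div_self_antitoneOn` — and `1/T ≤ 1/(2s)`; the ζ twin `Budget.liErrFar_le` verbatim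
  with `log(qT) = L + log T`);
* `charCountMain q s ≤ 0.3184 s (u − 17/6)` (`log 2π ≥ 11/6`);
* `argSRem q s ≤ 12.975 u + 34.72` (`n ≥ 10⁴`; `log 9.1902 ≤ 2.25`, `log(s + 4) ≤ log s + 4/s` — tree `SchoenfeldBound.log_add_le`);
* `0 ≤ bmorEll q s ≤ u + 2/s − 11/6`, `bmorRem q s ≤ 0.39404 u + 2.2206` and the oscillatory errors `charErrOscB/P`,
  the only non-affine ingredient, BMOR's `log(1 + ℓ)`, being linearised by the tangent line `log y ≤ 3/2 + y/12`
  (`e^{5/2} ≥ 12`).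
Nothing here bears on the truth of RH or GRH.
-/

noncomputable section

-- D-0017: `Summit.<S>.<S>.…` is the designed namespace of a single-problem summit.
set_option linter.dupNamespace false

open Real Set

namespace Summit.RiemannHypothesis.RiemannHypothesis.Theorems.LiTheory

open Literature.NumberTheory.LFunctions

namespace BudgetChar

/-! ### Numerical constants -/

/-- `log 2π ≥ 11/6` (`e^{11} < (2π)^6`). -/
theorem log_two_pi_ge : (11 / 6 : ℝ) ≤ Real.log (2 * π) := by
  rw [Real.le_log_iff_exp_le (by positivity)]
  have he := Real.exp_one_lt_d9
  have hπ := Real.pi_gt_d4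
  have h6 : Real.exp (11 / 6) ^ 6 = Real.exp 1 ^ 11 := by
    rw [← Real.exp_nat_mul, ← Real.exp_nat_mul]; norm_num
  have hlt : Real.exp (11 / 6) ^ 6 < (2 * π) ^ 6 := by
    rw [h6]
    calc Real.exp 1 ^ 11 < 2.7182818286 ^ 11 := pow_lt_pow_left₀ he (Real.exp_pos 1).le (by norm_num)
      _ < (2 * 3.1415) ^ 6 := by norm_num
      _ < (2 * π) ^ 6 := pow_lt_pow_left₀ (by linarith) (by norm_num) (by norm_num)
  exact (lt_of_pow_lt_pow_left₀ 6 (by positivity) hlt).le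

/-- The tangent line of `log` at `e^{5/2} ≥ 12` (tree `Handoff.exp_five_half_ge`): `log y ≤ 3/2 + y/12` for `y > 0`. -/
theorem log_le_tangent {y : ℝ} (hy : 0 < y) : Real.log y ≤ 3 / 2 + y / 12 := by
  have h1 : Real.log y = Real.log (y * Real.exp (-(5 / 2))) + 5 / 2 := by
    rw [Real.log_mul hy.ne' (Real.exp_ne_zero _), Real.log_exp]; ring
  have h2 : Real.log (y * Real.exp (-(5 / 2))) ≤ y * Real.exp (-(5 / 2)) - 1 :=
    Real.log_le_sub_one_of_pos (by positivity)
  have h3 : Real.exp (-(5 / 2 : ℝ)) ≤ 1 / 12 := by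
    rw [Real.exp_neg, one_div]
    exact inv_anti₀ (by norm_num) Handoff.exp_five_half_ge
  have h4 : y * Real.exp (-(5 / 2 : ℝ)) ≤ y * (1 / 12) := mul_le_mul_of_nonneg_left h3 hy.le
  linarith

/-- `log 9.1902 ≤ 2.25` (`9.1902⁴ < e⁹`). -/
theorem log_91902_le : Real.log 9.1902 ≤ 2.25 := by
  rw [Real.log_le_iff_le_exp (by norm_num)]
  have he := Real.exp_one_gt_d9
  have h4 : Real.exp 2.25 ^ 4 = Real.exp 1 ^ 9 := by
    rw [← Real.exp_nat_mul, ← Real.exp_nat_mul]; norm_num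
  have hlt : (9.1902 : ℝ) ^ 4 < Real.exp 2.25 ^ 4 := by
    rw [h4]
    calc (9.1902 : ℝ) ^ 4 < 2.7182818283 ^ 9 := by norm_num
      _ < Real.exp 1 ^ 9 := pow_lt_pow_left₀ he (by norm_num) (by norm_num)
  exact (lt_of_pow_lt_pow_left₀ 4 (Real.exp_pos _).le hlt).le

/-! ### Atoms: `s = √n`, `log n` -/

/-- For `n ≥ 900`: `√n ≥ 30`, `(√n)² = n`, `log √n = (log n)/2`, `log n ≥ 6.75`. -/
theorem sqrt_facts {n : ℕ} (hn : 900 ≤ n) :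
    30 ≤ Real.sqrt n ∧ Real.sqrt n ^ 2 = n ∧ Real.log (Real.sqrt n) = Real.log n / 2 ∧
      6.75 ≤ Real.log n := by
  have hnR : (900 : ℝ) ≤ n := by exact_mod_cast hn
  have hn0 : (0 : ℝ) ≤ n := by positivity
  refine ⟨?_, Real.sq_sqrt hn0, Real.log_sqrt hn0,
    Budget.log_900_ge.trans (Real.log_le_log (by norm_num) hnR)⟩
  rw [show (30 : ℝ) = Real.sqrt (30 ^ 2) by rw [Real.sqrt_sq (by norm_num)]]
  exact Real.sqrt_le_sqrt (by linarith)

/-! ### The four pieces, linearised -/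

variable {q n : ℕ} {T : ℝ}

set_option maxHeartbeats 400000 in
/-- FAR term on the admissible region (`n ≥ 900`, `n ≤ T²/4`, `q ≥ 2`):
`charErrFar q n T ≤ (0.0562 √n + 0.0398)(log q + (log n)/2 + 0.6932)`. -/
theorem charErrFar_le (hq : 2 ≤ q) (hn : 900 ≤ n) (hnc : (n : ℝ) ≤ 1 / 4 * T ^ 2) (hT : 0 < T) :
    charErrFar q n T ≤
      (0.0562 * Real.sqrt n + 0.0398) * (Real.log q + Real.log n / 2 + 0.6932) := by
  have hπ := Real.pi_gt_d4
  obtain ⟨hs30, hs2, hlogs, hLn⟩ := sqrt_facts hn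
  have hn0 : (0 : ℝ) ≤ n := by positivity
  set s := Real.sqrt n with hs
  set Ln := Real.log n with hLn'
  set L := Real.log q with hL
  have hqR : (2 : ℝ) ≤ q := by exact_mod_cast hq
  have hq0 : (0 : ℝ) < q := by linarith
  have hL0 : 0 ≤ L := Real.log_nonneg (by linarith)
  have hs0 : 0 < s := by linarith
  -- `T ≥ 2s`
  have hT2s : 2 * s ≤ T := by
    have : (2 * s) ^ 2 ≤ T ^ 2 := by nlinarith
    nlinarith [sq_nonneg (T - 2 * s), sq_nonneg (T + 2 * s)]
  -- `log T/T ≤ log(2s)/(2s)`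
  have he1 : Real.exp 1 ≤ 2 * s := by
    have := Real.exp_one_lt_d9; linarith
  have hanti := Real.log_div_self_antitoneOn he1 (he1.trans hT2s) hT2s
  simp only at hanti
  have hlog2s : Real.log (2 * s) ≤ 0.6932 + Ln / 2 := by
    rw [Real.log_mul two_ne_zero hs0.ne', hlogs]
    linarith [Real.log_two_lt_d9]
  -- `log(qT)/T ≤ W/(2s)`, `W = L + Ln/2 + 0.6932`
  set W := L + Ln / 2 + 0.6932 with hW
  have hW0 : 0 ≤ W := by positivity
  have hlogqT : Real.log (q * T) = L + Real.log T := Real.log_mul hq0.ne' hT.ne'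
  have hquot : Real.log (q * T) / T ≤ W / (2 * s) := by
    rw [hlogqT, add_div]
    have h1 : L / T ≤ L / (2 * s) := div_le_div_of_nonneg_left hL0 (by positivity) hT2s
    have h2 : Real.log T / T ≤ (0.6932 + Ln / 2) / (2 * s) :=
      hanti.trans (div_le_div_of_nonneg_right hlog2s (by linarith))
    have e : W / (2 * s) = L / (2 * s) + (0.6932 + Ln / 2) / (2 * s) := by rw [hW]; ring
    rw [e]
    exact add_le_add h1 h2
  have hquot0 : 0 ≤ Real.log (q * T) / T :=
    div_nonneg (Real.log_nonneg (by nlinarith)) hT.le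
  -- Term 1: `2.82 n² log(qT)/(2πT³) = (2.82 n²/(2π)) (log(qT)/T) (1/T²)`, `1/T² ≤ 1/(4s²)`
  have hT2 : (1 : ℝ) / T ^ 2 ≤ 1 / (4 * s ^ 2) := by
    apply div_le_div_of_nonneg_left zero_le_one (by positivity)
    nlinarith
  have h1 : 2.82 * (n : ℝ) ^ 2 * (Real.log (q * T) / (2 * π * T ^ 3)) ≤
      2.82 / (16 * π) * s * W := by
    have e : 2.82 * (n : ℝ) ^ 2 * (Real.log (q * T) / (2 * π * T ^ 3)) =
        2.82 * (n : ℝ) ^ 2 / (2 * π) * ((Real.log (q * T) / T) * (1 / T ^ 2)) := by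
      field_simp
    rw [e]
    have hprod : (Real.log (q * T) / T) * (1 / T ^ 2) ≤ (W / (2 * s)) * (1 / (4 * s ^ 2)) :=
      mul_le_mul hquot hT2 (by positivity) (by positivity)
    calc 2.82 * (n : ℝ) ^ 2 / (2 * π) * ((Real.log (q * T) / T) * (1 / T ^ 2))
        ≤ 2.82 * (n : ℝ) ^ 2 / (2 * π) * ((W / (2 * s)) * (1 / (4 * s ^ 2))) :=
          mul_le_mul_of_nonneg_left hprod (by positivity)
      _ = 2.82 / (16 * π) * s * W := by
          rw [← hs2]; field_simp; ring
  -- Term 2: `(n/2) log(qT)/(πT²) = (n/(2π)) (log(qT)/T) (1/T)`, `1/T ≤ 1/(2s)`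
  have hT1 : (1 : ℝ) / T ≤ 1 / (2 * s) := div_le_div_of_nonneg_left zero_le_one (by positivity) hT2s
  have h2 : (n : ℝ) / 2 * (Real.log (q * T) / (π * T ^ 2)) ≤ W / (8 * π) := by
    have e : (n : ℝ) / 2 * (Real.log (q * T) / (π * T ^ 2)) =
        (n : ℝ) / (2 * π) * ((Real.log (q * T) / T) * (1 / T)) := by
      field_simp
    rw [e]
    have hprod : (Real.log (q * T) / T) * (1 / T) ≤ (W / (2 * s)) * (1 / (2 * s)) :=
      mul_le_mul hquot hT1 (by positivity) (by positivity)
    calc (n : ℝ) / (2 * π) * ((Real.log (q * T) / T) * (1 / T))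
        ≤ (n : ℝ) / (2 * π) * ((W / (2 * s)) * (1 / (2 * s))) :=
          mul_le_mul_of_nonneg_left hprod (by positivity)
      _ = W / (8 * π) := by
          rw [← hs2]; field_simp; ring
  -- numerics
  have hc1 : 2.82 / (16 * π) ≤ 0.0562 := by
    rw [div_le_iff₀ (by positivity)]; nlinarith [Real.pi_gt_d4]
  have hc2 : W / (8 * π) ≤ 0.0398 * W := by
    rw [div_le_iff₀ (by positivity)]; nlinarith [Real.pi_gt_d4]
  have hsW : 0 ≤ s * W := by positivity
  unfold charErrFar
  calc 2.82 * (n : ℝ) ^ 2 * (Real.log (q * T) / (2 * π * T ^ 3)) + (n : ℝ) / 2 * (Real.log (q * T) / (π * T ^ 2))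
      ≤ 2.82 / (16 * π) * s * W + W / (8 * π) := add_le_add h1 h2
    _ ≤ 0.0562 * (s * W) + 0.0398 * W := by
        rw [mul_assoc]
        exact add_le_add (mul_le_mul_of_nonneg_right hc1 hsW) hc2
    _ = (0.0562 * s + 0.0398) * W := by ring

/-- COUNTING MAIN TERM at `√n` (`n ≥ 900`, `q ≥ 2`): `charCountMain q √n ≤ 0.3184 √n (log q + (log n)/2 − 17/6)`. -/
theorem charCountMain_le (hq : 2 ≤ q) (hn : 900 ≤ n) :
    charCountMain q (Real.sqrt n) ≤ 0.3184 * Real.sqrt n * (Real.log q + Real.log n / 2 - 17 / 6) := by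
  have hπ := Real.pi_gt_d4
  obtain ⟨hs30, -, hlogs, hLn⟩ := sqrt_facts hn
  set s := Real.sqrt n with hs
  have hqR : (2 : ℝ) ≤ q := by exact_mod_cast hq
  have hq0 : (0 : ℝ) < q := by linarith
  have hL0 : 0 ≤ Real.log q := Real.log_nonneg (by linarith)
  have hs0 : 0 < s := by linarith
  have h2π := log_two_pi_ge
  have hlog : Real.log (q * s / (2 * π * Real.exp 1)) = Real.log q + Real.log n / 2 - Real.log (2 * π) - 1 := by
    rw [Real.log_div (by positivity) (by positivity), Real.log_mul hq0.ne' hs0.ne',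
      Real.log_mul (by positivity) (Real.exp_ne_zero 1), Real.log_exp, hlogs]
    ring
  unfold charCountMain
  rw [hlog]
  have hY0 : 0 ≤ Real.log q + Real.log n / 2 - 17 / 6 := by linarith
  have hle : Real.log q + Real.log n / 2 - Real.log (2 * π) - 1 ≤ Real.log q + Real.log n / 2 - 17 / 6 := by
    linarith
  have hπinv : s / π ≤ 0.3184 * s := by
    rw [div_le_iff₀ Real.pi_pos]; nlinarith
  calc s / π * (Real.log q + Real.log n / 2 - Real.log (2 * π) - 1)
      ≤ s / π * (Real.log q + Real.log n / 2 - 17 / 6) := mul_le_mul_of_nonneg_left hle (by positivity)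
    _ ≤ 0.3184 * s * (Real.log q + Real.log n / 2 - 17 / 6) := mul_le_mul_of_nonneg_right hπinv hY0

/-- The tree's remainder at `√n` (`n ≥ 10⁴`, `q ≥ 2`): `argSRem q √n ≤ 12.975 (log q + (log n)/2) + 34.72`. -/
theorem argSRem_le (hq : 2 ≤ q) (hn : 10000 ≤ n) :
    argSRem q (Real.sqrt n) ≤ 12.975 * (Real.log q + Real.log n / 2) + 34.72 := by
  obtain ⟨-, -, hlogs, -⟩ := sqrt_facts (le_trans (by norm_num) hn)
  have hnR : (10000 : ℝ) ≤ n := by exact_mod_cast hn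
  set s := Real.sqrt n with hs
  have hs100 : 100 ≤ s := by
    rw [hs, show (100 : ℝ) = Real.sqrt (100 ^ 2) by rw [Real.sqrt_sq (by norm_num)]]
    exact Real.sqrt_le_sqrt (by linarith)
  have hs0 : 0 < s := by linarith
  have hqR : (2 : ℝ) ≤ q := by exact_mod_cast hq
  have hq0 : (0 : ℝ) < q := by linarith
  have hlog : Real.log (9.1902 * q * (s + 4)) = Real.log 9.1902 + Real.log q + Real.log (s + 4) := by
    rw [Real.log_mul (by positivity) (by positivity), Real.log_mul (by norm_num) hq0.ne']
  have h4 : Real.log (s + 4) ≤ Real.log s + 4 / s := SchoenfeldBound.log_add_le hs0 (by norm_num)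
  have h4s : 4 / s ≤ 0.04 := by
    rw [div_le_iff₀ hs0]; linarith
  have h9 := log_91902_le
  unfold argSRem
  rw [hlog]
  rw [hlogs] at h4
  nlinarith

/-- BMOR's `ℓ` at `√n` (`n ≥ 900`, `q ≥ 2`): `0 ≤ bmorEll q √n ≤ log q + (log n)/2 + 2/√n − 11/6`. -/
theorem bmorEll_bounds (hq : 2 ≤ q) (hn : 900 ≤ n) :
    0 ≤ bmorEll q (Real.sqrt n) ∧
      bmorEll q (Real.sqrt n) ≤ Real.log q + Real.log n / 2 + 2 / Real.sqrt n - 11 / 6 := by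
  have hπ := Real.pi_gt_d4
  have hπ' := Real.pi_lt_d4
  obtain ⟨hs30, -, hlogs, -⟩ := sqrt_facts hn
  set s := Real.sqrt n with hs
  have hs0 : 0 < s := by linarith
  have hqR : (2 : ℝ) ≤ q := by exact_mod_cast hq
  have hq0 : (0 : ℝ) < q := by linarith
  constructor
  · unfold bmorEll
    apply Real.log_nonneg
    rw [le_div_iff₀ (by positivity)]
    nlinarith
  · unfold bmorEll
    rw [Real.log_div (by positivity) (by positivity), Real.log_mul hq0.ne' (by positivity)]
    have h2 : Real.log (s + 2) ≤ Real.log s + 2 / s := SchoenfeldBound.log_add_le hs0 (by norm_num)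
    rw [hlogs] at h2
    linarith [log_two_pi_ge]

/-- BMOR's remainder at `√n` (`n ≥ 900`, `q ≥ 2`): `bmorRem q √n ≤ 0.39404 (log q + (log n)/2) + 2.2206`. -/
theorem bmorRem_le (hq : 2 ≤ q) (hn : 900 ≤ n) :
    bmorRem q (Real.sqrt n) ≤ 0.39404 * (Real.log q + Real.log n / 2) + 2.2206 := by
  obtain ⟨hs30, -, -, hLn⟩ := sqrt_facts hn
  obtain ⟨hℓ0, hℓ⟩ := bmorEll_bounds hq hn
  set s := Real.sqrt n with hs
  set ℓ := bmorEll q (Real.sqrt n) with hℓ'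
  have hs0 : 0 < s := by linarith
  have hqR : (2 : ℝ) ≤ q := by exact_mod_cast hq
  have hL0 : 0 ≤ Real.log q := Real.log_nonneg (by linarith)
  have htan : Real.log (1 + ℓ) ≤ 3 / 2 + (1 + ℓ) / 12 := log_le_tangent (by linarith)
  have h2s : 2 / s ≤ 1 / 15 := by
    rw [div_le_iff₀ hs0]; linarith
  unfold bmorRem
  nlinarith

/-- BMOR OSCILLATORY error (`n ≥ 900`, `q ≥ 2`), linearised:
`charErrOscB q n ≤ 0.39404 (√n log q + √n (log n)/2) + 3.2812 √n + 0.78808 (log q + (log n)/2) + 6.2293`. -/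
theorem charErrOscB_le (hq : 2 ≤ q) (hn : 900 ≤ n) :
    charErrOscB q n ≤ 0.39404 * (Real.sqrt n * Real.log q + Real.sqrt n * (Real.log n / 2))
      + 3.2812 * Real.sqrt n + 0.78808 * (Real.log q + Real.log n / 2) + 6.2293 := by
  have hπ := Real.pi_gt_d4
  obtain ⟨hs30, -, hlogs, hLn⟩ := sqrt_facts hn
  obtain ⟨hℓ0, hℓ⟩ := bmorEll_bounds hq hn
  have hrem := bmorRem_le hq hn
  set s := Real.sqrt n with hs
  set ℓ := bmorEll q (Real.sqrt n) with hℓ'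
  set L := Real.log q with hL
  set Ln := Real.log n with hLn'
  have hs0 : 0 < s := by linarith
  have hqR : (2 : ℝ) ≤ q := by exact_mod_cast hq
  have hq0 : (0 : ℝ) < q := by linarith
  have hL0 : 0 ≤ L := Real.log_nonneg (by linarith)
  have htan : Real.log (1 + ℓ) ≤ 3 / 2 + (1 + ℓ) / 12 := log_le_tangent (by linarith)
  -- `s · log(s + 2) ≤ s (log n)/2 + 2`
  have h2 : Real.log (s + 2) ≤ Real.log s + 2 / s := SchoenfeldBound.log_add_le hs0 (by norm_num)
  rw [hlogs] at h2
  have hs2 : s * Real.log (s + 2) ≤ s * (Ln / 2) + 2 := by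
    have := mul_le_mul_of_nonneg_left h2 hs0.le
    have e : s * (Ln / 2 + 2 / s) = s * (Ln / 2) + 2 := by field_simp
    linarith
  -- `s · ℓ ≤ s L + s (log n)/2 + 2 − (11/6) s`
  have hsℓ : s * ℓ ≤ s * L + s * (Ln / 2) + 2 - 11 / 6 * s := by
    have := mul_le_mul_of_nonneg_left hℓ hs0.le
    have e : s * (L + Ln / 2 + 2 / s - 11 / 6) = s * L + s * (Ln / 2) + 2 - 11 / 6 * s := by field_simp
    linarith
  -- `s · log(1 + ℓ) ≤ s (3/2 + (1 + ℓ)/12)`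
  have hslog : s * Real.log (1 + ℓ) ≤ s * (3 / 2) + s / 12 + s * ℓ / 12 := by
    have := mul_le_mul_of_nonneg_left htan hs0.le
    linarith
  unfold charErrOscB
  have e1 : s * (0.22737 * (L + Real.log (s + 2)) + 2 * Real.log (1 + ℓ) + 0.42) =
      0.22737 * (s * L) + 0.22737 * (s * Real.log (s + 2)) + 2 * (s * Real.log (1 + ℓ)) + 0.42 * s := by ring
  rw [e1]
  nlinarith

/-- TREE OSCILLATORY error (`n ≥ 10⁴`, `q ≥ 2`), linearised:
`charErrOscP q n ≤ 12.975 (√n log q + √n (log n)/2) + 46.8 √n + 25.95 (log q + (log n)/2) + 122.34`. -/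
theorem charErrOscP_le (hq : 2 ≤ q) (hn : 10000 ≤ n) :
    charErrOscP q n ≤ 12.975 * (Real.sqrt n * Real.log q + Real.sqrt n * (Real.log n / 2))
      + 46.8 * Real.sqrt n + 25.95 * (Real.log q + Real.log n / 2) + 122.34 := by
  obtain ⟨hs30, -, hlogs, hLn⟩ := sqrt_facts (le_trans (by norm_num) hn)
  have hA := argSRem_le hq hn
  set s := Real.sqrt n with hs
  set L := Real.log q with hL
  set Ln := Real.log n with hLn'
  have hs0 : 0 < s := by linarith
  have h4 : Real.log (s + 4) ≤ Real.log s + 4 / s := SchoenfeldBound.log_add_le hs0 (by norm_num)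
  rw [hlogs] at h4
  have hs4 : s * Real.log (s + 4) ≤ s * (Ln / 2) + 4 := by
    have := mul_le_mul_of_nonneg_left h4 hs0.le
    have e : s * (Ln / 2 + 4 / s) = s * (Ln / 2) + 4 := by field_simp
    linarith
  unfold charErrOscP
  have e1 : s * (12.975 * (L + Real.log (s + 4)) + 46.8) =
      12.975 * (s * L) + 12.975 * (s * Real.log (s + 4)) + 46.8 * s := by ring
  rw [e1]
  linarith

end BudgetChar

end Summit.RiemannHypothesis.RiemannHypothesis.Theorems.LiTheory

end
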